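import Summits.BirchSwinnertonDyer.BirchSwinnertonDyer.Theorems.PrintCFramJZeroThreeUnitRegimePsi5K11
import Literature.NumberTheory.QuadraticFields.KroneckerSplitting
import HarnessLib

/-! # K12r@3 — the «3-unit regime» at `p = 3` for a PRIME PAIR `(q, −r)`, BERNOULLI LAYER: the two
# Bernoulli-unit certificates of Kriz–Li Thm. 1.20 for `ψ = (·/q)`, `K = ℚ(√−r)` reduced to the
# INTEGER conditions `3 ∤ S₁(q,r) := Σ_{j<qr} (j/q)(j/r)·j` and `3 ∥ S₂(q) := Σ_{j<3q} (j/q)(j/3)·j`,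
# plus `hεK` for `d_K = −r` and the binder `hB` (cell `bsd-print-cfram`, seat p3 g2; regime N =
# `TorsionFreeFrameBSDThree`, stmt-BirchSwinnertonDyer-20698; generic form of `…UnitRegimePsi5K11`)

HONEST FRAMING (cell `bsd-print-cfram`, run/shared/lean/pub/bsd-print-cfram/, D-0131 (2) print
tier; verbatim in every file of the cell): the cell works the partition leaf
`CornerF ∧ p ramified in the CM field K` (LADDER-BSD row K7r = B13; W-ALL row 12r) in PARTITION
currency — a leaf or a cell counts only when its theorem is in the kernel BY NAME. Nothing here is a
Literature statement, no named fact is introduced, nothing is asserted about BSD; beyond-print: NO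
(Dirichlet-character bookkeeping; the `(q, r)`-generic form of `PrintCFramJZeroThreeUnitRegimePsi5K11`,
whose `(5, 11)` certificates were `decide`d in place — here the two finite sums are HYPOTHESES that
each instance file decides, so one kernel theorem serves every prime pair of P3-UNIT-REGIME-CENSUS §5).

For odd primes `q ≠ r`, both `≠ 3`, with `χ_q = (·/q)`, `χ_r = (·/r)` the `ℚ₃`-valued Legendre
characters (`PrintCFram.exists_legendreCharacter_three`) and `ω` a Teichmüller character mod `3`
(`= (·/3)`, `PrintCFram.teichmuller_three_apply_eq_legendreSym`):
* §1 `θ₁ = χ_q⁻¹↑·χ_r↑` (level `q·r`, prime to `3`): values `(j/q)(j/r)`, PRIMITIVE, `≠ 1`, and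
  `‖B_{1,θ₁}‖₃ = 1` from `3 ∤ S₁` (`PrintCFram.norm_generalizedBernoulli_one_eq_one_of_intCert`;
  `S₁ = qr·B_{1,θ₁} = −2qr·h(−qr)/w` when `q ≡ 1 (mod 4)`, `r ≡ 3 (mod 4)`).
* §2 `θ₂ = χ_q↑·ω⁻¹↑` (level `3q`): values `(j/q)(j/3)` exactly, PRIMITIVE, `≠ 1`, and
  `‖B_{1,θ₂}‖₃ = 1` from `3 ∣ S₂ ∧ 9 ∤ S₂` (bsd-cm's `RouteU.norm_generalizedBernoulli_one_eq_one_of_cert`,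
  exponent `0`).
* §3 `isKroneckerCharacterOf_legendre` — `hεK` for `d_K = −r`, `r ≡ 3 (mod 4)` prime
  (`PrintCFram.isKroneckerCharacterOf_three_changeLevel_jacobi`); **`bernoulli_hypothesis_prime_pair`**
  — the binder `hB : ¬ ‖B_{1,ψ₀⁻¹ε_K} · B_{1,ψ₀ω⁻¹}‖₃ ≤ 3⁻¹` of
  `JZeroThree.bsdp_three_of_thm120_unitRegime` for `(ψ, ε_K, ω) = (χ_q, χ_r↑, ω)`, `q ≡ 1 (mod 4)`
  (`ψ` even; `PrintCFram.bernoulli_hypothesis_three_of_even`), modulo the two integer certificates.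
Instances (decided elsewhere): `(5, 11)`: `S₁ = −220`, `S₂ = −30` (p546318); `(17, 47)`: `S₁ = −12784`,
`S₂ = −102`; `(41, 23)`: `S₁ = −15088`, `S₂ = −246`; `(5, 59)`: `S₁ = −2360`.
References: [KrizLi2019] Thm. 1.20 (p. 8), §1.5 (1) (p. 7), §2 (pp. 11–12); [Washington1997] Ch. 3,
§5.1, Thm. 4.2; [Cox2013] §1.C Lemma 1.14; `X12/O11/RouteUBernoulliD11.lean`,
`RouteUBernoulliCertificate.lean` (bsd-cm, the `p = 7` pattern).
-/

set_option linter.dupNamespace false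
set_option autoImplicit false

noncomputable section

open scoped Classical
open NumberField DirichletCharacter Literature.NumberTheory.EllipticCurves.KrizLi2019
  Literature.NumberTheory.LFunctions Literature.NumberTheory.QuadraticFields
  Summit.BirchSwinnertonDyer.Rank1Residual.X12.O11.RouteU

namespace Summit.BirchSwinnertonDyer.BirchSwinnertonDyer.Theorems.PrintCFram

/-! ## §1 `θ₁ = χ_q⁻¹↑·χ_r↑` at level `q·r` -/

section ThetaOne

variable {q r : ℕ} [hq : Fact q.Prime] [hr : Fact r.Prime]
  (χq : DirichletCharacter ℚ_[3] q) (χr : DirichletCharacter ℚ_[3] r)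
  (hχq : ∀ a : ℕ, χq (a : ZMod q) = (legendreSym q (a : ℤ) : ℚ_[3]))
  (hχr : ∀ a : ℕ, χr (a : ZMod r) = (legendreSym r (a : ℤ) : ℚ_[3]))

include hχq hχr

/-- Values of `θ₁ = χ_q⁻¹↑·χ_r↑` at level `q·r`: `θ₁(j) = (j/q)(j/r)` (both sides vanish off the
units). [cite: KrizLi2019, §2 (p. 11)] -/
theorem thetaOne_pair_apply (j : ZMod (q * r)) :
    (changeLevel (dvd_mul_right q r) χq⁻¹ * changeLevel (dvd_mul_left r q) χr :
      DirichletCharacter ℚ_[3] (q * r)) j =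
      ((legendreSym q (j.val : ℤ) * legendreSym r (j.val : ℤ) : ℤ) : ℚ_[3]) := by
  haveI : NeZero (q * r) := ⟨mul_ne_zero hq.out.ne_zero hr.out.ne_zero⟩
  have hinv : χq⁻¹ = χq := inv_eq_of_mul_eq_one_right (legendreChar_three_mul_self χq hχq)
  have hj : ((j.val : ℤ) : ZMod (q * r)) = j := by rw [Int.cast_natCast, ZMod.natCast_zmod_val]
  rw [hinv]
  by_cases hu : IsCoprime (j.val : ℤ) ((q * r : ℕ) : ℤ)
  · conv_lhs => rw [← hj]
    rw [MulChar.mul_apply, changeLevel_eq_cast_of_dvd' _ _ hu, changeLevel_eq_cast_of_dvd' _ _ hu,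
      Int.cast_natCast, Int.cast_natCast, hχq, hχr, Int.cast_mul]
  · have hnu : ¬ IsUnit j := by
      rw [← hj, ZMod.coe_int_isUnit_iff_isCoprime]; exact fun h => hu (by simpa [isCoprime_comm] using h)
    rw [MulChar.map_nonunit _ hnu]
    have hc : ¬ (j.val).Coprime (q * r) := fun h => hu (Nat.isCoprime_iff_coprime.mpr h)
    rw [Nat.coprime_mul_iff_right, not_and_or] at hc
    rcases hc with h1 | h1
    · have hd : q ∣ j.val := by
        rwa [Nat.coprime_comm, Nat.Prime.coprime_iff_not_dvd hq.out, not_not] at h1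
      rw [(legendreSym.eq_zero_iff q _).mpr (by rw [Int.cast_natCast]; exact (ZMod.natCast_eq_zero_iff _ _).mpr hd)]
      simp
    · have hd : r ∣ j.val := by
        rwa [Nat.coprime_comm, Nat.Prime.coprime_iff_not_dvd hr.out, not_not] at h1
      rw [(legendreSym.eq_zero_iff r _).mpr (by rw [Int.cast_natCast]; exact (ZMod.natCast_eq_zero_iff _ _).mpr hd)]
      simp

/-- **`θ₁ = χ_q⁻¹↑·χ_r↑` is PRIMITIVE of conductor `q·r`** (`q ≠ r` odd primes).
[cite: Washington1997, Ch. 3 (conductor of a product of characters of coprime conductor)] -/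
theorem thetaOne_pair_isPrimitive (hq2 : q ≠ 2) (hr2 : r ≠ 2) (hqr : q ≠ r) :
    (changeLevel (dvd_mul_right q r) χq⁻¹ * changeLevel (dvd_mul_left r q) χr :
      DirichletCharacter ℚ_[3] (q * r)).IsPrimitive := by
  haveI : NeZero (q * r) := ⟨mul_ne_zero hq.out.ne_zero hr.out.ne_zero⟩
  have hcq : χq⁻¹.conductor = q := by
    rw [conductor_inv, conductor_eq_of_prime_of_ne_one χq (legendreChar_three_ne_one χq hχq hq2)]
  have hcr : χr.conductor = r :=
    conductor_eq_of_prime_of_ne_one χr (legendreChar_three_ne_one χr hχr hr2)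
  rw [isPrimitive_def, conductor_changeLevel_mul_changeLevel _ _ χq⁻¹ χr
    (by rw [hcq, hcr]; exact (Nat.coprime_primes hq.out hr.out).mpr hqr), hcq, hcr]

/-- `θ₁ ≠ 1` (its conductor is `q·r ≠ 1`). [cite: Washington1997, Ch. 3] -/
theorem thetaOne_pair_ne_one (hq2 : q ≠ 2) (hr2 : r ≠ 2) (hqr : q ≠ r) :
    (changeLevel (dvd_mul_right q r) χq⁻¹ * changeLevel (dvd_mul_left r q) χr :
      DirichletCharacter ℚ_[3] (q * r)) ≠ 1 := by
  haveI : NeZero (q * r) := ⟨mul_ne_zero hq.out.ne_zero hr.out.ne_zero⟩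
  intro h1
  have hc := (eq_one_iff_conductor_eq_one).mp h1
  rw [(isPrimitive_def _).mp (thetaOne_pair_isPrimitive χq χr hχq hχr hq2 hr2 hqr)] at hc
  exact hq.out.one_lt.ne' (Nat.eq_one_of_mul_eq_one_right hc)

/-- **CERTIFICATE 1 (generic): `‖B_{1,θ₁}‖₃ = 1` for `θ₁ = χ_q⁻¹χ_r` from `3 ∤ S₁`,
`S₁ = Σ_{j<qr} (j/q)(j/r)·j`** (level `q·r` prime to `3`; `S₁ = qr·B_{1,θ₁}`).
[cite: KrizLi2019, Thm. 1.20 (p. 8) and §1.5 (1)] [cite: Washington1997, Thm. 4.2] -/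
theorem norm_generalizedBernoulli_thetaOne_pair (hq2 : q ≠ 2) (hr2 : r ≠ 2) (hqr : q ≠ r)
    (hq3 : q ≠ 3) (hr3 : r ≠ 3)
    (hS₁ : ¬ ((3 : ℤ) ∣ ∑ j ∈ Finset.range (q * r),
      legendreSym q (j : ℤ) * legendreSym r (j : ℤ) * (j : ℤ))) :
    ‖generalizedBernoulli 1 (changeLevel (dvd_mul_right q r) χq⁻¹ *
        changeLevel (dvd_mul_left r q) χr : DirichletCharacter ℚ_[3] (q * r))‖ = 1 := by
  haveI : NeZero (q * r) := ⟨mul_ne_zero hq.out.ne_zero hr.out.ne_zero⟩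
  have h3 : ¬ 3 ∣ q * r := by
    rw [Nat.Prime.dvd_mul Nat.prime_three, not_or]
    exact ⟨fun h => hq3 ((Nat.prime_dvd_prime_iff_eq Nat.prime_three hq.out).mp h).symm,
      fun h => hr3 ((Nat.prime_dvd_prime_iff_eq Nat.prime_three hr.out).mp h).symm⟩
  refine norm_generalizedBernoulli_one_eq_one_of_intCert _
    (thetaOne_pair_ne_one χq χr hχq hχr hq2 hr2 hqr) h3
    (fun j => legendreSym q (j.val : ℤ) * legendreSym r (j.val : ℤ))
    (fun j => thetaOne_pair_apply χq χr hχq hχr j) ?_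
  rwa [sum_univ_zmod_eq_sum_range (fun j => legendreSym q (j : ℤ) * legendreSym r (j : ℤ) * (j : ℤ))]

end ThetaOne

/-! ## §2 `θ₂ = χ_q↑·ω⁻¹↑` at level `3q` -/

section ThetaTwo

variable {q : ℕ} [hq : Fact q.Prime] (χq : DirichletCharacter ℚ_[3] q) (ω : DirichletCharacter ℚ_[3] 3)
  (hχq : ∀ a : ℕ, χq (a : ZMod q) = (legendreSym q (a : ℤ) : ℚ_[3])) (hω : IsTeichmullerCharacter ω)

include hχq hω

/-- Values of `θ₂ = χ_q↑·ω⁻¹↑` at level `q·3`: `θ₂(j) = (j/q)(j/3)` EXACTLY (`ω⁻¹ = ω = (·/3)`).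
[cite: KrizLi2019, §2 (p. 11)] -/
theorem thetaTwo_pair_apply (j : ZMod (q * 3)) :
    (changeLevel (dvd_mul_right q 3) χq * changeLevel (dvd_mul_left 3 q) ω⁻¹ :
      DirichletCharacter ℚ_[3] (q * 3)) j =
      ((legendreSym q (j.val : ℤ) * legendreSym 3 (j.val : ℤ) : ℤ) : ℚ_[3]) := by
  haveI : NeZero (q * 3) := ⟨mul_ne_zero hq.out.ne_zero (by norm_num)⟩
  have hj : ((j.val : ℤ) : ZMod (q * 3)) = j := by rw [Int.cast_natCast, ZMod.natCast_zmod_val]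
  rw [teichmuller_three_inv_eq hω]
  by_cases hu : IsCoprime (j.val : ℤ) ((q * 3 : ℕ) : ℤ)
  · conv_lhs => rw [← hj]
    rw [MulChar.mul_apply, changeLevel_eq_cast_of_dvd' _ _ hu, changeLevel_eq_cast_of_dvd' _ _ hu,
      Int.cast_natCast, Int.cast_natCast, hχq, teichmuller_three_apply_eq_legendreSym hω, Int.cast_mul]
  · have hnu : ¬ IsUnit j := by
      rw [← hj, ZMod.coe_int_isUnit_iff_isCoprime]; exact fun h => hu (by simpa [isCoprime_comm] using h)
    rw [MulChar.map_nonunit _ hnu]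
    have hc : ¬ (j.val).Coprime (q * 3) := fun h => hu (Nat.isCoprime_iff_coprime.mpr h)
    rw [Nat.coprime_mul_iff_right, not_and_or] at hc
    rcases hc with h1 | h1
    · have hd : q ∣ j.val := by
        rwa [Nat.coprime_comm, Nat.Prime.coprime_iff_not_dvd hq.out, not_not] at h1
      rw [(legendreSym.eq_zero_iff q _).mpr (by rw [Int.cast_natCast]; exact (ZMod.natCast_eq_zero_iff _ _).mpr hd)]
      simp
    · have hd : 3 ∣ j.val := by
        rwa [Nat.coprime_comm, Nat.Prime.coprime_iff_not_dvd Nat.prime_three, not_not] at h1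
      rw [(legendreSym.eq_zero_iff 3 _).mpr (by rw [Int.cast_natCast]; exact (ZMod.natCast_eq_zero_iff _ _).mpr hd)]
      simp

/-- **`θ₂ = χ_q↑·ω⁻¹↑` is PRIMITIVE of conductor `3q`** (`q ≠ 3` an odd prime). [cite: Washington1997, Ch. 3] -/
theorem thetaTwo_pair_isPrimitive (hq2 : q ≠ 2) (hq3 : q ≠ 3) :
    (changeLevel (dvd_mul_right q 3) χq * changeLevel (dvd_mul_left 3 q) ω⁻¹ :
      DirichletCharacter ℚ_[3] (q * 3)).IsPrimitive := by
  haveI : NeZero (q * 3) := ⟨mul_ne_zero hq.out.ne_zero (by norm_num)⟩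
  have hcq : χq.conductor = q :=
    conductor_eq_of_prime_of_ne_one χq (legendreChar_three_ne_one χq hχq hq2)
  have hc3 : ω⁻¹.conductor = 3 := by
    rw [conductor_inv]
    exact conductor_eq_of_prime_of_ne_one ω (ne_one_of_isTeichmullerCharacter (by norm_num) hω)
  rw [isPrimitive_def, conductor_changeLevel_mul_changeLevel _ _ χq ω⁻¹
    (by rw [hcq, hc3]; exact (Nat.coprime_primes hq.out Nat.prime_three).mpr hq3), hcq, hc3]

/-- `θ₂ ≠ 1` (its conductor is `3q ≠ 1`). [cite: Washington1997, Ch. 3] -/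
theorem thetaTwo_pair_ne_one (hq2 : q ≠ 2) (hq3 : q ≠ 3) :
    (changeLevel (dvd_mul_right q 3) χq * changeLevel (dvd_mul_left 3 q) ω⁻¹ :
      DirichletCharacter ℚ_[3] (q * 3)) ≠ 1 := by
  haveI : NeZero (q * 3) := ⟨mul_ne_zero hq.out.ne_zero (by norm_num)⟩
  intro h1
  have hc := (eq_one_iff_conductor_eq_one).mp h1
  rw [(isPrimitive_def _).mp (thetaTwo_pair_isPrimitive χq ω hχq hω hq2 hq3)] at hc
  exact hq.out.one_lt.ne' (Nat.eq_one_of_mul_eq_one_right hc)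

/-- **CERTIFICATE 2 (generic): `‖B_{1,θ₂}‖₃ = 1` for `θ₂ = χ_qω` from `3 ∥ S₂`,
`S₂ = Σ_{j<3q} (j/q)(j/3)·j`** (level `3q`, `3 ∥ 3q`; `B_{1,θ₂} = S₂/(3q)`) — bsd-cm's certificate
`RouteU.norm_generalizedBernoulli_one_eq_one_of_cert` with exponent `0` (exact values).
[cite: KrizLi2019, Thm. 1.20 (p. 8) and §1.5 (1)] [cite: Washington1997, Thm. 4.2] -/
theorem norm_generalizedBernoulli_thetaTwo_pair (hq2 : q ≠ 2) (hq3 : q ≠ 3)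
    (hS₂ : (3 : ℤ) ∣ ∑ j ∈ Finset.range (q * 3),
      legendreSym q (j : ℤ) * legendreSym 3 (j : ℤ) * (j : ℤ) ^ (0 + 1))
    (hS₂' : ¬ ((3 : ℤ) ^ 2 ∣ ∑ j ∈ Finset.range (q * 3),
      legendreSym q (j : ℤ) * legendreSym 3 (j : ℤ) * (j : ℤ) ^ (0 + 1))) :
    ‖generalizedBernoulli 1 (changeLevel (dvd_mul_right q 3) χq *
        changeLevel (dvd_mul_left 3 q) ω⁻¹ : DirichletCharacter ℚ_[3] (q * 3))‖ = 1 := by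
  haveI : NeZero (q * 3) := ⟨mul_ne_zero hq.out.ne_zero (by norm_num)⟩
  have hq3' : ¬ 3 ∣ q := fun h =>
    hq3 ((Nat.prime_dvd_prime_iff_eq Nat.prime_three hq.out).mp h).symm
  have hv : padicValNat 3 (q * 3) = 1 := by
    rw [padicValNat.mul hq.out.ne_zero (by norm_num), padicValNat.eq_zero_of_not_dvd hq3',
      padicValNat_self]
  refine norm_generalizedBernoulli_one_eq_one_of_cert _ (thetaTwo_pair_ne_one χq ω hχq hω hq2 hq3) hv
    (fun j => legendreSym q (j.val : ℤ) * legendreSym 3 (j.val : ℤ)) 0 (fun j => ?_) ?_ ?_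
  · rw [thetaTwo_pair_apply χq ω hχq hω j, pow_zero, mul_one, sub_self, norm_zero]
    positivity
  · rwa [sum_univ_zmod_eq_sum_range
      (fun j => legendreSym q (j : ℤ) * legendreSym 3 (j : ℤ) * (j : ℤ) ^ (0 + 1))]
  · rwa [sum_univ_zmod_eq_sum_range
      (fun j => legendreSym q (j : ℤ) * legendreSym 3 (j : ℤ) * (j : ℤ) ^ (0 + 1))]

end ThetaTwo

/-! ## §3 `hεK` for `d_K = −r` and `hB` for `(χ_q, χ_r↑, ω)` modulo the two certificates -/

/-- **`hεK` for `d_K = −r`, `r ≡ 3 (mod 4)` prime**: for a quadratic field `K` with `d_K = −r` and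
`χ_r` the `ℚ₃`-valued Legendre character mod `r`, `changeLevel (r ∣ |d_K|) χ_r` is the Kronecker
character of `K`. [cite: KrizLi2019, §2 (p. 12)] [cite: Cox2013, §1.C Lemma 1.14] -/
theorem isKroneckerCharacterOf_legendre {r : ℕ} [hr : Fact r.Prime] (hr4 : r % 4 = 3)
    {K : Type} [Field K] [NumberField K]
    (hK2 : Module.finrank ℚ K = 2) (hdK : NumberField.discr K = -(r : ℤ))
    (χr : DirichletCharacter ℚ_[3] r)
    (hχr : ∀ a : ℕ, χr (a : ZMod r) = (legendreSym r (a : ℤ) : ℚ_[3]))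
    (h : r ∣ (NumberField.discr K).natAbs) :
    IsKroneckerCharacterOf K (changeLevel h χr) :=
  haveI : NeZero r := ⟨hr.out.ne_zero⟩
  isKroneckerCharacterOf_three_changeLevel_jacobi hK2 hr4 hdK χr
    (legendreChar_three_isPrimitive χr hχr (by omega))
    (fun a => by rw [hχr, jacobiSym.legendreSym.to_jacobiSym]) h

/-- **`hB` for `(ψ, ε_K, ω) = (χ_q, χ_r↑, ω)` modulo the two integer certificates**: the Bernoulli
hypothesis of Kriz–Li Thm. 1.20 at `p = 3` — `¬ ‖B_{1,ψ₀⁻¹ε_K} · B_{1,ψ₀ω⁻¹}‖₃ ≤ 3⁻¹` — for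
`q ≡ 1 (mod 4)` (so `ψ = χ_q` is EVEN), `r` an odd prime `≠ q`, both `≠ 3`, from `3 ∤ S₁(q, r)` and
`3 ∥ S₂(q)` (§1, §2, `bernoulli_hypothesis_three_of_even`). `D` is any level divisible by `r` (in the
application `D = |d_K| = r`). [cite: KrizLi2019, Thm. 1.20 (p. 8, the Bernoulli hypothesis)] -/
theorem bernoulli_hypothesis_prime_pair {q r : ℕ} [hq : Fact q.Prime] [hr : Fact r.Prime]
    (hq4 : q % 4 = 1) (hr2 : r ≠ 2) (hqr : q ≠ r) (hq3 : q ≠ 3) (hr3 : r ≠ 3)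
    {D : ℕ} [NeZero D] (h : r ∣ D)
    (χq : DirichletCharacter ℚ_[3] q) (hχq : ∀ a : ℕ, χq (a : ZMod q) = (legendreSym q (a : ℤ) : ℚ_[3]))
    (χr : DirichletCharacter ℚ_[3] r) (hχr : ∀ a : ℕ, χr (a : ZMod r) = (legendreSym r (a : ℤ) : ℚ_[3]))
    (ω : DirichletCharacter ℚ_[3] 3) (hω : IsTeichmullerCharacter ω)
    (hS₁ : ¬ ((3 : ℤ) ∣ ∑ j ∈ Finset.range (q * r),
      legendreSym q (j : ℤ) * legendreSym r (j : ℤ) * (j : ℤ)))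
    (hS₂ : (3 : ℤ) ∣ ∑ j ∈ Finset.range (q * 3),
      legendreSym q (j : ℤ) * legendreSym 3 (j : ℤ) * (j : ℤ) ^ (0 + 1))
    (hS₂' : ¬ ((3 : ℤ) ^ 2 ∣ ∑ j ∈ Finset.range (q * 3),
      legendreSym q (j : ℤ) * legendreSym 3 (j : ℤ) * (j : ℤ) ^ (0 + 1))) :
    ¬ (‖bernoulliOnePrim (bernoulliCharOne χq (changeLevel h χr)) *
        bernoulliOnePrim (bernoulliCharTwo χq (changeLevel h χr) ω)‖ ≤ ((3 : ℕ) : ℝ)⁻¹) := by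
  haveI : NeZero q := ⟨hq.out.ne_zero⟩
  haveI : NeZero r := ⟨hr.out.ne_zero⟩
  have hq2 : q ≠ 2 := by omega
  have hev : χq.Even := by
    show χq (-1) = 1
    have hneg : (-1 : ZMod q) = ((q - 1 : ℕ) : ZMod q) := by
      rw [Nat.cast_sub hq.out.one_le, Nat.cast_one, ZMod.natCast_self, zero_sub]
    have hL : legendreSym q ((q - 1 : ℕ) : ℤ) = 1 := by
      rw [Nat.cast_sub hq.out.one_le, Nat.cast_one,
        show ((q : ℕ) : ℤ) - 1 = -1 + (q : ℤ) * 1 by ring, legendreSym.mod q (-1 + (q : ℤ) * 1),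
        Int.add_mul_emod_self_left, ← legendreSym.mod, legendreSym.at_neg_one hq2,
        ZMod.χ₄_nat_one_mod_four hq4]
    rw [hneg, hχq, hL, Int.cast_one]
  exact bernoulli_hypothesis_three_of_even χq hev χr h ω
    (thetaOne_pair_isPrimitive χq χr hχq hχr hq2 hr2 hqr)
    (norm_generalizedBernoulli_thetaOne_pair χq χr hχq hχr hq2 hr2 hqr hq3 hr3 hS₁)
    (thetaTwo_pair_isPrimitive χq ω hχq hω hq2 hq3)
    (norm_generalizedBernoulli_thetaTwo_pair χq ω hχq hω hq2 hq3 hS₂ hS₂')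

end Summit.BirchSwinnertonDyer.BirchSwinnertonDyer.Theorems.PrintCFram

end
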